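import Mathlib.Algebra.Polynomial.Roots
import Mathlib.Algebra.Polynomial.BigOperators
import Mathlib.Analysis.Complex.Basic
import HarnessLib

/-!
# Products over conjugate-closed families of complex numbers

Bookkeeping for the passage from a complex factorisation `∏_l (T − ζ_l)^{k_l}` of a REAL polynomial
to its real form: the roots come as real ones and conjugate pairs `ζ, ζ̄`, paired factors combine
to `(T − re ζ)² + (im ζ)²`, and the exponents are constant on pairs.

* `eq_of_prod_X_sub_C_pow_eq` — for pairwise distinct `ζ_l`, the exponents `k_l` in
  `∏_l (X − ζ_l)^{k_l}` are determined by the polynomial (root multiplicities);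
* `exp_comp_perm_eq` — if conjugation permutes the (distinct) `ζ_l` through an involution `τ`
  and `∏_l (X − ζ_l)^{k_l}` has real coefficients (is fixed by coefficientwise conjugation), then
  `k ∘ τ = k`;
* `prod_pow_sub_eq_ofReal` — for real `t`,
  `∏_l (t − ζ_l)^{k_l} = ∏_{τ l = l} (t − re ζ_l)^{k_l} · ∏_{l < τ l} ((t − re ζ_l)² + (im ζ_l)²)^{k_l}`,
  a real number.

## References

* Standard (real and complex roots of real polynomials); e.g. S. Lang, *Algebra*, IV §1, V §2.
-/

noncomputable section

open Polynomial Finset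
open scoped ComplexConjugate

namespace Literature.Algebra.Polynomial

variable {n : ℕ}

/-- The roots, with multiplicity, of `∏_l (X − ζ_l)^{k_l}`. [folklore] -/
theorem roots_prod_X_sub_C_pow {K : Type*} [CommRing K] [IsDomain K] (z : Fin n → K)
    (k : Fin n → ℕ) :
    (∏ l, (X - C (z l)) ^ k l).roots = ∑ l, k l • ({z l} : Multiset K) := by
  classical
  have hne : (∏ l, (X - C (z l)) ^ k l) ≠ 0 :=
    prod_ne_zero_iff.2 fun l _ => pow_ne_zero _ (X_sub_C_ne_zero _)
  rw [roots_prod _ _ hne]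
  simp only [roots_pow, roots_X_sub_C]
  rfl

/-- **Exponents are root multiplicities.** For pairwise distinct `ζ_l`, the exponents in
`∏_l (X − ζ_l)^{k_l}` are determined by the product. [folklore] -/
theorem eq_of_prod_X_sub_C_pow_eq {K : Type*} [CommRing K] [IsDomain K] {z : Fin n → K}
    (hz : Function.Injective z) {k k' : Fin n → ℕ}
    (h : ∏ l, (X - C (z l)) ^ k l = ∏ l, (X - C (z l)) ^ k' l) : k = k' := by
  classical
  have hcount : ∀ (m : Fin n → ℕ) (l : Fin n),
      (∑ l', m l' • ({z l'} : Multiset K)).count (z l) = m l := by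
    intro m l
    rw [Multiset.count_sum']
    simp only [Multiset.count_nsmul, Multiset.count_singleton, hz.eq_iff]
    rw [Finset.sum_eq_single l (fun l' _ hl' => by simp [Ne.symm hl']) (by simp)]
    simp
  funext l
  have h' := congrArg (fun p => p.roots.count (z l)) h
  simp only [roots_prod_X_sub_C_pow, hcount] at h'
  exact h'

/-- **Exponents of a real factorisation are constant on conjugate pairs.** If conjugation permutes
the pairwise distinct `ζ_l` through the involution `τ` (`ζ_{τ l} = conj ζ_l`) and the polynomial
`∏_l (X − ζ_l)^{k_l}` is fixed by coefficientwise conjugation, then `k (τ l) = k l`. [folklore] -/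
theorem exp_comp_perm_eq {z : Fin n → ℂ} (hz : Function.Injective z) {k : Fin n → ℕ}
    {τ : Fin n → Fin n} (hτ : Function.Involutive τ) (hzτ : ∀ l, z (τ l) = conj (z l))
    (hreal : (∏ l, (X - C (z l)) ^ k l).map (starRingEnd ℂ) = ∏ l, (X - C (z l)) ^ k l) (l : Fin n) :
    k (τ l) = k l := by
  have hmap : (∏ l, (X - C (z l)) ^ k l).map (starRingEnd ℂ) = ∏ l, (X - C (z l)) ^ k (τ l) := by
    rw [Polynomial.map_prod]
    simp only [Polynomial.map_pow, Polynomial.map_sub, map_X, map_C, ← hzτ]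
    exact Fintype.prod_equiv hτ.toPerm _ _ fun l => by simp [hτ l]
  rw [hmap] at hreal
  exact (congrFun (eq_of_prod_X_sub_C_pow_eq hz hreal) l)

/-- For real `t` and complex `z`: `(t − z)(t − z̄) = (t − re z)² + (im z)²`. [folklore] -/
theorem sub_mul_sub_conj (t : ℝ) (z : ℂ) :
    ((t : ℂ) - z) * ((t : ℂ) - conj z) = (((t - z.re) ^ 2 + z.im ^ 2 : ℝ) : ℂ) := by
  apply Complex.ext
  · simp only [Complex.mul_re, Complex.sub_re, Complex.ofReal_re, Complex.conj_re, Complex.sub_im,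
      Complex.ofReal_im, Complex.conj_im]
    ring
  · simp only [Complex.mul_im, Complex.sub_re, Complex.ofReal_re, Complex.conj_re, Complex.sub_im,
      Complex.ofReal_im, Complex.conj_im]
    ring

/-- **Real form of a conjugate-closed product.** Let `τ` be an involution of the indices with
`ζ_{τ l} = conj ζ_l` and `k ∘ τ = k`. Then for real `t` the product `∏_l (t − ζ_l)^{k_l}` is the
real number `∏_{τ l = l} (t − re ζ_l)^{k_l} · ∏_{l < τ l} ((t − re ζ_l)² + (im ζ_l)²)^{k_l}` (real
roots, and one representative of each conjugate pair). [folklore] -/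
theorem prod_pow_sub_eq_ofReal {z : Fin n → ℂ} {k : Fin n → ℕ} {τ : Fin n → Fin n}
    (hτ : Function.Involutive τ) (hzτ : ∀ l, z (τ l) = conj (z l)) (hk : ∀ l, k (τ l) = k l)
    (t : ℝ) :
    ∏ l, ((t : ℂ) - z l) ^ k l =
      (((∏ l ∈ univ.filter (fun l => τ l = l), (t - (z l).re) ^ k l) *
        ∏ l ∈ univ.filter (fun l => τ l ≠ l ∧ l < τ l),
          ((t - (z l).re) ^ 2 + (z l).im ^ 2) ^ k l : ℝ) : ℂ) := by
  classical
  set f : Fin n → ℂ := fun l => ((t : ℂ) - z l) ^ k l with hf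
  -- split the index set into fixed points, representatives `l < τ l`, and their images
  have h1 := (Finset.prod_filter_mul_prod_filter_not (univ : Finset (Fin n)) (fun l => τ l = l) f).symm
  have h2 := (Finset.prod_filter_mul_prod_filter_not ((univ : Finset (Fin n)).filter fun l => ¬τ l = l)
    (fun l => l < τ l) f).symm
  rw [Finset.filter_filter, Finset.filter_filter] at h2
  have himage : ((univ : Finset (Fin n)).filter fun l => ¬τ l = l ∧ ¬l < τ l) =
      ((univ : Finset (Fin n)).filter fun l => ¬τ l = l ∧ l < τ l).image τ := by
    ext m
    simp only [Finset.mem_filter, Finset.mem_univ, true_and, Finset.mem_image]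
    constructor
    · rintro ⟨hm, hlt⟩
      refine ⟨τ m, ⟨by rw [hτ m]; exact fun h => hm h.symm, ?_⟩, hτ m⟩
      rw [hτ m]
      exact lt_of_le_of_ne (not_lt.1 hlt) hm
    · rintro ⟨l, ⟨hl, hlt⟩, rfl⟩
      rw [hτ l]
      exact ⟨fun h => hl h.symm, not_lt.2 hlt.le⟩
  have h3 : ∏ m ∈ ((univ : Finset (Fin n)).filter fun l => ¬τ l = l ∧ ¬l < τ l), f m =
      ∏ l ∈ ((univ : Finset (Fin n)).filter fun l => ¬τ l = l ∧ l < τ l), f (τ l) := by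
    rw [himage, Finset.prod_image fun x _ y _ h => hτ.injective h]
  rw [show ∏ l, ((t : ℂ) - z l) ^ k l = ∏ l, f l from rfl, h1, h2, h3, ← Finset.prod_mul_distrib]
  push_cast
  congr 1
  · refine Finset.prod_congr rfl fun l hl => ?_
    have him : (z l).im = 0 := by
      have h := hzτ l
      rw [(Finset.mem_filter.1 hl).2] at h
      exact Complex.conj_eq_iff_im.1 h.symm
    rw [hf]
    simp only
    congr 1
    exact Complex.ext (by simp) (by simp [him])
  · refine Finset.prod_congr (by simp [ne_eq]) fun l _ => ?_
    rw [hf]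
    simp only
    rw [hk l, ← mul_pow, hzτ l, sub_mul_sub_conj]
    push_cast
    ring

end Literature.Algebra.Polynomial
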